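import Mathlib
import Literature.Combinatorics.Enumerative.TransferMatrixMethod
import Literature.Computability.AlgebraicComplexity.StandardFamilies
import Summits.ValiantsHypothesis.ValiantsHypothesis.Theorems.GrenetZeonTwoDimCoefficientsDefs
import Summits.ValiantsHypothesis.ValiantsHypothesis.Theorems.GrenetZeonTwoDimCoefficientsScalingCompanionDegree

/-!
# Crux `GrenetZeon.TwoDimCoefficients` (stmt-ValiantsHypothesis-8062), stub `stub_dualUnipotent`:
# scaling-closure — the FIRST COMPANION is the square-trace of the numerator

The scaling-closure method (`…ScalingClosure*.lean`, `…ScalingShadowFamily.lean`) refutes a unipotent dual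
representation `per_n = α·c + β·tr(adj A·B)` (`det A = c ≠ 0`, `A, B` affine `m × m`) from the SHADOW
`Φ = c + β⁻¹·per_n + Σ_{2 ≤ k ≤ m/n} [D_k]_{kn}`, `D_k = [X^k] det(X·B + A)`, whenever the companions `[D_k]_{kn}`
vanish or are torus-unstable.  For `m < 3n` the only companion order is `k = 2`.  This file PINS `D₂` to one
explicit polynomial, the square-trace `W = tr((adj A·B)²)` of the numerator `adj A·B`:

* `two_mul_coeff_charpolyRev_two` — Newton's identity at order two for the reversed characteristic
  polynomial of a matrix over any commutative ring: `2·[X²] det(1 − X·M) = (tr M)² − tr(M²)` (from the tree's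
  logarithmic-derivative identity `charpolyRev_mul_mk_trace_pow_succ`, Stanley EC1 Cor. 4.7.3);
* ★ `two_mul_det_mul_coeff_det_two` — for square matrices `A, B` over any commutative ring with `det A` a unit,
  `2·det A·[X²] det(X·B + A) = tr(adj A·B)² − tr((adj A·B)²)`;
* ★ `coeff_det_two_eq_of_det_eq_C`, `companionTwo_eq` — in the crux's vocabulary (`det A = c ≠ 0`,
  `per_n = α·det A + β·tr(adj A·B)`): `D₂ = (2c)⁻¹·((β⁻¹(per_n − αc))² − W)`;
* ★ `homogeneousComponent_coeff_det_two_of_lt` / `…_two_mul` — hence `[D₂]_d = −(2c)⁻¹·[W]_d` for `d > 2n`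
  and `[D₂]_{2n} = (2c)⁻¹·(β⁻²·per_n² − [W]_{2n})`: the order-two companion data of the method is EXACTLY the
  top part `[W]_{≥ 2n}` of the single polynomial `W = tr((adj A·B)²)`;
* ★ `three_mul_le_of_sqTrace` — consequently (via ✓ `sq_le_two_mul_of_lowCompanionFree`): for `n ≥ 6`, a unipotent
  dual representation with `[W]_d = 0` for `2n < d ≤ m` and `[W]_{2n} = β⁻²·per_n²` has `m ≥ 3n`.

In the nilpotent-pencil normal form (`A = 1 + L`, `B = M`, `tr(L^j M) = δ_{j,n−1}·per_n`) one has
`[W]_d = Σ_{a+b=d−2} tr(L^a M L^b M) = (2/d)·[u²] tr((L + uM)^d)`: the order-two companion is the SECOND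
VARIATION of the power traces of the pencil `L + uM` (the first variations being `δ_{d,n}·n·per_n`); this
reformulation is recorded in the hand's memo, not used here.

HONEST FRAMING: an identity and one bookkeeping corollary for a conditional-on-shape method; the stub
`DualUnipotentBound`, the crux and `VP ≠ VNP` remain open.

References: R. P. Stanley, *Enumerative Combinatorics* 1, 2nd ed., Cor. 4.7.3 (via the tree's
`Literature.Combinatorics.Enumerative.charpolyRev_mul_mk_trace_pow_succ`); T. Mignon, N. Ressayre,
Int. Math. Res. Not. 2004:79, Thm. 1.1 (via the tree).
-/

-- single-conjunct layout `Summits/ValiantsHypothesis/ValiantsHypothesis`: the duplicated namespace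
-- component is mandated by the tree.
set_option linter.dupNamespace false
set_option autoImplicit false

noncomputable section

namespace Summit.ValiantsHypothesis.ValiantsHypothesis.Theorems.GrenetZeonTwoDimCoefficients.ScalingClosure

open MvPolynomial Matrix
open Literature.Computability.AlgebraicComplexity
open Summit.ValiantsHypothesis.ValiantsHypothesis.Cruxes.TwoDimCoefficients.DimTwoCases

/-! ### Newton's identity at order two for `det(1 − X·M)` and for `det(X·B + A)` -/

section Newton

variable {R : Type*} [CommRing R] {ι : Type*} [Fintype ι] [DecidableEq ι]

/-- **Newton at order two.**  For a square matrix `M` over a commutative ring,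
`2·[X²] det(1 − X·M) = (tr M)² − tr(M²)` (the `X¹`-coefficient of the tree's identity
`det(1 − X·M)·Σ tr(M^{j+1})X^j = −(d/dX) det(1 − X·M)`). [cite: Stanley2012EC1, Corollary 4.7.3] -/
theorem two_mul_coeff_charpolyRev_two (M : Matrix ι ι R) :
    2 * M.charpolyRev.coeff 2 = M.trace ^ 2 - (M ^ 2).trace := by
  have h := congrArg (PowerSeries.coeff 1)
    (Literature.Combinatorics.Enumerative.charpolyRev_mul_mk_trace_pow_succ M)
  simp only [PowerSeries.coeff_mul, Finset.Nat.sum_antidiagonal_succ, Finset.Nat.antidiagonal_zero,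
    Finset.sum_singleton, Polynomial.coeff_coe, PowerSeries.coeff_mk, map_neg,
    Polynomial.coeff_derivative, zero_add, pow_one] at h
  have h0 : M.charpolyRev.coeff 0 = 1 := by
    rw [Polynomial.coeff_zero_eq_eval_zero, Matrix.eval_charpolyRev]
  rw [h0, Matrix.coeff_charpolyRev_eq_neg_trace] at h
  norm_num at h
  linear_combination h

/-- ★ **The `X²`-coefficient of `det(X·B + A)`.**  For square matrices `A, B` over a commutative ring with
`det A` a unit, `2·det A·[X²] det(X·B + A) = tr(adj A·B)² − tr((adj A·B)²)`
(`det(X·B + A) = det A·det(1 + X·A⁻¹B)`, `A⁻¹ = (det A)⁻¹ adj A`, and Newton at order two). [folklore] -/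
theorem two_mul_det_mul_coeff_det_two (A B : Matrix ι ι R) (hA : IsUnit A.det) :
    2 * A.det * (det ((Polynomial.X : Polynomial R) • B.map Polynomial.C + A.map Polynomial.C)).coeff 2 =
      (A.adjugate * B).trace ^ 2 - ((A.adjugate * B) ^ 2).trace := by
  obtain ⟨v, hv⟩ := hA.exists_right_inv
  set P := A.adjugate * B with hP
  have hAN : A * (v • P) = B := by
    rw [Matrix.mul_smul, hP, ← Matrix.mul_assoc, Matrix.mul_adjugate, Matrix.smul_mul, Matrix.one_mul,
      smul_smul, mul_comm v, hv, one_smul]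
  have hfac : (Polynomial.X : Polynomial R) • B.map Polynomial.C + A.map Polynomial.C =
      A.map Polynomial.C * (1 - (Polynomial.X : Polynomial R) • (-(v • P)).map Polynomial.C) := by
    rw [Matrix.mul_sub, Matrix.mul_one, Matrix.mul_smul, ← Matrix.map_mul, Matrix.mul_neg, hAN,
      Matrix.map_neg _ (map_neg Polynomial.C), smul_neg, sub_neg_eq_add, add_comm]
  have hdet : det ((Polynomial.X : Polynomial R) • B.map Polynomial.C + A.map Polynomial.C) =
      Polynomial.C A.det * (-(v • P)).charpolyRev := by
    rw [hfac, det_mul, Matrix.charpolyRev]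
    congr 1
    rw [← RingHom.mapMatrix_apply, ← RingHom.map_det]
  rw [hdet, Polynomial.coeff_C_mul]
  have h2 := two_mul_coeff_charpolyRev_two (-(v • P))
  rw [trace_neg, neg_sq, neg_sq, show (v • P) ^ 2 = v ^ 2 • P ^ 2 from _root_.smul_pow v P 2, trace_smul,
    trace_smul, smul_eq_mul, smul_eq_mul] at h2
  have e : 2 * A.det * (A.det * (-(v • P)).charpolyRev.coeff 2) =
      A.det ^ 2 * (2 * (-(v • P)).charpolyRev.coeff 2) := by ring
  rw [e, h2]
  linear_combination (P.trace ^ 2 - (P ^ 2).trace) * (A.det * v + 1) * hv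

end Newton

/-! ### The first companion in the crux's vocabulary -/

section Crux

variable {σ : Type*} {ι : Type*} [Fintype ι] [DecidableEq ι]

/-- ★ **`D₂ = (2c)⁻¹·(tr(adj A·B)² − tr((adj A·B)²))`** when `det A = c ≠ 0` (matrices over a complex polynomial
ring; `D₂ = [X²] det(X·B + A)`). [folklore] -/
theorem coeff_det_two_eq_of_det_eq_C (A B : Matrix ι ι (MvPolynomial σ ℂ)) (c : ℂ) (hc : c ≠ 0)
    (hdet : A.det = MvPolynomial.C c) :
    (det ((Polynomial.X : Polynomial (MvPolynomial σ ℂ)) • B.map Polynomial.C + A.map Polynomial.C)).coeff 2 =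
      MvPolynomial.C (2 * c)⁻¹ * ((A.adjugate * B).trace ^ 2 - ((A.adjugate * B) ^ 2).trace) := by
  have hu : IsUnit A.det := by
    rw [hdet]
    exact (isUnit_iff_ne_zero.mpr hc).map MvPolynomial.C
  have h := two_mul_det_mul_coeff_det_two A B hu
  rw [hdet] at h
  rw [← h, ← mul_assoc, ← mul_assoc, ← map_ofNat (MvPolynomial.C : ℂ →+* MvPolynomial σ ℂ) 2, ← map_mul,
    ← map_mul, show ((2 * c)⁻¹ * (OfNat.ofNat 2 : ℂ) * c : ℂ) = 1 by
      rw [mul_assoc, inv_mul_cancel₀ (mul_ne_zero two_ne_zero hc)], map_one, one_mul]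

/-- Under `per_n = α·det A + β·tr(adj A·B)`, `det A = c`, `β ≠ 0`, the numerator trace is
`tr(adj A·B) = β⁻¹·(per_n − αc)`. [folklore] -/
theorem trace_adjugate_mul_eq_of_per {n : Type*} [Fintype n] [DecidableEq n]
    (A B : Matrix ι ι (MvPolynomial (n × n) ℂ)) (α β c : ℂ) (hβ : β ≠ 0)
    (hdet : A.det = MvPolynomial.C c)
    (hper : perPoly n ℂ = MvPolynomial.C α * A.det + MvPolynomial.C β * (A.adjugate * B).trace) :
    (A.adjugate * B).trace = MvPolynomial.C β⁻¹ * (perPoly n ℂ - MvPolynomial.C (α * c)) := by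
  rw [hper, hdet, ← map_mul, add_sub_cancel_left, ← mul_assoc, ← map_mul, inv_mul_cancel₀ hβ, map_one,
    one_mul]

/-- ★ **The first companion, explicitly.**  `det A = c ≠ 0`, `per_n = α·det A + β·tr(adj A·B)`, `β ≠ 0` ⟹
`D₂ = (2c)⁻¹·((β⁻¹(per_n − αc))² − tr((adj A·B)²))`. [folklore] -/
theorem companionTwo_eq {n : Type*} [Fintype n] [DecidableEq n]
    (A B : Matrix ι ι (MvPolynomial (n × n) ℂ)) (α β c : ℂ) (hc : c ≠ 0) (hβ : β ≠ 0)
    (hdet : A.det = MvPolynomial.C c)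
    (hper : perPoly n ℂ = MvPolynomial.C α * A.det + MvPolynomial.C β * (A.adjugate * B).trace) :
    (det ((Polynomial.X : Polynomial (MvPolynomial (n × n) ℂ)) • B.map Polynomial.C +
        A.map Polynomial.C)).coeff 2 =
      MvPolynomial.C (2 * c)⁻¹ *
        ((MvPolynomial.C β⁻¹ * (perPoly n ℂ - MvPolynomial.C (α * c))) ^ 2 - ((A.adjugate * B) ^ 2).trace) := by
  rw [coeff_det_two_eq_of_det_eq_C A B c hc hdet, trace_adjugate_mul_eq_of_per A B α β c hβ hdet hper]

/-- The homogeneous components of `(β⁻¹(per_n − αc))²`: only degrees `0`, `n`, `2n` occur; above `2n`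
nothing. [folklore] -/
theorem homogeneousComponent_numerator_sq_of_lt {n : ℕ} (α β c : ℂ) {d : ℕ} (hd : 2 * n < d) :
    homogeneousComponent d
      ((MvPolynomial.C β⁻¹ * (perPoly (Fin n) ℂ - MvPolynomial.C (α * c))) ^ 2) = 0 := by
  have hP : (perPoly (Fin n) ℂ).IsHomogeneous n := by
    simpa only [Fintype.card_fin] using (perPoly_isHomogeneous (n := Fin n) (k := ℂ))
  have e : (MvPolynomial.C β⁻¹ * (perPoly (Fin n) ℂ - MvPolynomial.C (α * c))) ^ 2 =
      MvPolynomial.C (β⁻¹ ^ 2) * (perPoly (Fin n) ℂ * perPoly (Fin n) ℂ) +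
        MvPolynomial.C (-(2 * β⁻¹ ^ 2 * (α * c))) * perPoly (Fin n) ℂ +
        MvPolynomial.C (β⁻¹ ^ 2 * (α * c) ^ 2) := by
    simp only [map_pow, map_mul, map_neg, map_ofNat]
    ring
  rw [e, map_add, map_add, homogeneousComponent_C_mul, homogeneousComponent_C_mul,
    homogeneousComponent_of_mem ((mem_homogeneousSubmodule _ _).mpr (hP.mul hP)),
    homogeneousComponent_of_mem ((mem_homogeneousSubmodule _ _).mpr hP),
    homogeneousComponent_of_mem ((mem_homogeneousSubmodule _ _).mpr (isHomogeneous_C _ _)),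
    if_neg (by omega), if_neg (by omega), if_neg (by omega), mul_zero, mul_zero, add_zero, add_zero]

/-- The degree-`2n` component of `(β⁻¹(per_n − αc))²` is `β⁻²·per_n²` (`n ≥ 1`). [folklore] -/
theorem homogeneousComponent_numerator_sq_two_mul {n : ℕ} (hn : 0 < n) (α β c : ℂ) :
    homogeneousComponent (2 * n)
      ((MvPolynomial.C β⁻¹ * (perPoly (Fin n) ℂ - MvPolynomial.C (α * c))) ^ 2) =
        MvPolynomial.C (β⁻¹ ^ 2) * perPoly (Fin n) ℂ ^ 2 := by
  have hP : (perPoly (Fin n) ℂ).IsHomogeneous n := by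
    simpa only [Fintype.card_fin] using (perPoly_isHomogeneous (n := Fin n) (k := ℂ))
  have e : (MvPolynomial.C β⁻¹ * (perPoly (Fin n) ℂ - MvPolynomial.C (α * c))) ^ 2 =
      MvPolynomial.C (β⁻¹ ^ 2) * (perPoly (Fin n) ℂ * perPoly (Fin n) ℂ) +
        MvPolynomial.C (-(2 * β⁻¹ ^ 2 * (α * c))) * perPoly (Fin n) ℂ +
        MvPolynomial.C (β⁻¹ ^ 2 * (α * c) ^ 2) := by
    simp only [map_pow, map_mul, map_neg, map_ofNat]
    ring
  rw [e, map_add, map_add, homogeneousComponent_C_mul, homogeneousComponent_C_mul,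
    homogeneousComponent_of_mem ((mem_homogeneousSubmodule _ _).mpr (hP.mul hP)),
    homogeneousComponent_of_mem ((mem_homogeneousSubmodule _ _).mpr hP),
    homogeneousComponent_of_mem ((mem_homogeneousSubmodule _ _).mpr (isHomogeneous_C _ _)),
    if_pos (by omega), if_neg (by omega), if_neg (by omega), mul_zero, add_zero, add_zero,
    ← pow_two (perPoly (Fin n) ℂ)]

/-- ★ **Order-two companion data above `2n` = top of the square-trace.**  For `d > 2n`:
`[D₂]_d = −(2c)⁻¹·[tr((adj A·B)²)]_d`. [folklore] -/
theorem homogeneousComponent_coeff_det_two_of_lt {n m : ℕ} (A B : AffMat n m) (α β c : ℂ) (hc : c ≠ 0)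
    (hβ : β ≠ 0) (hdet : A.det = MvPolynomial.C c)
    (hper : perPoly (Fin n) ℂ = MvPolynomial.C α * A.det + MvPolynomial.C β * (A.adjugate * B).trace)
    {d : ℕ} (hd : 2 * n < d) :
    homogeneousComponent d ((det ((Polynomial.X : Polynomial (MvPolynomial (Fin n × Fin n) ℂ)) •
        B.map Polynomial.C + A.map Polynomial.C)).coeff 2) =
      -(MvPolynomial.C (2 * c)⁻¹ * homogeneousComponent d (((A.adjugate * B) ^ 2).trace)) := by
  rw [companionTwo_eq A B α β c hc hβ hdet hper, homogeneousComponent_C_mul, map_sub,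
    homogeneousComponent_numerator_sq_of_lt α β c hd, zero_sub, mul_neg]

/-- ★ **The order-two companion itself.**  `[D₂]_{2n} = (2c)⁻¹·(β⁻²·per_n² − [tr((adj A·B)²)]_{2n})`
(`n ≥ 1`). [folklore] -/
theorem homogeneousComponent_coeff_det_two_two_mul {n m : ℕ} (hn : 0 < n) (A B : AffMat n m) (α β c : ℂ)
    (hc : c ≠ 0) (hβ : β ≠ 0) (hdet : A.det = MvPolynomial.C c)
    (hper : perPoly (Fin n) ℂ = MvPolynomial.C α * A.det + MvPolynomial.C β * (A.adjugate * B).trace) :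
    homogeneousComponent (2 * n) ((det ((Polynomial.X : Polynomial (MvPolynomial (Fin n × Fin n) ℂ)) •
        B.map Polynomial.C + A.map Polynomial.C)).coeff 2) =
      MvPolynomial.C (2 * c)⁻¹ * (MvPolynomial.C (β⁻¹ ^ 2) * perPoly (Fin n) ℂ ^ 2 -
        homogeneousComponent (2 * n) (((A.adjugate * B) ^ 2).trace)) := by
  rw [companionTwo_eq A B α β c hc hβ hdet hper, homogeneousComponent_C_mul, map_sub,
    homogeneousComponent_numerator_sq_two_mul hn α β c]

end Crux

/-! ### Consequence: `m ≥ 3n` when the top of the square-trace is as small as it can be -/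

section ThreeN

/-- ★ **`m ≥ 3n` from the square-trace.**  Let `per_n = α·c + β·tr(adj A·B)` be a unipotent dual
representation (`det A = c ≠ 0`, `A, B` affine `m × m`, `n = k + 6 ≥ 6`, `m ≥ 2`) and put `W = tr((adj A·B)²)`.
If `[W]_d = 0` for `2n < d ≤ m` and `[W]_{2n} = β⁻²·per_n²` — i.e. the order-two companion data of the
scaling-closure method vanish — then `3n ≤ m`.  (For `m < 3n` the only companion order is `2`, so
✓ `sq_le_two_mul_of_lowCompanionFree` gives `n² ≤ 2m < 6n`.)
[cite: MignonRessayre2004, Thm. 1.1 — via the tree; folklore] -/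
theorem three_mul_le_of_sqTrace {k m : ℕ} (A B : AffMat (k + 6) m) (hA : IsAffine A) (hB : IsAffine B)
    (α β c : ℂ) (hc : c ≠ 0) (hβ : β ≠ 0) (hdet : A.det = MvPolynomial.C c)
    (hper : perPoly (Fin (k + 6)) ℂ =
      MvPolynomial.C α * A.det + MvPolynomial.C β * (A.adjugate * B).trace)
    (hm2 : 2 ≤ m)
    (hW : ∀ d, 2 * (k + 6) < d → d ≤ m → homogeneousComponent d (((A.adjugate * B) ^ 2).trace) = 0)
    (hW2 : homogeneousComponent (2 * (k + 6)) (((A.adjugate * B) ^ 2).trace) =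
      MvPolynomial.C (β⁻¹ ^ 2) * perPoly (Fin (k + 6)) ℂ ^ 2) :
    3 * (k + 6) ≤ m := by
  classical
  by_contra hlt
  rw [not_le] at hlt
  have hsq : (k + 3 + 3) ^ 2 ≤ 2 * m := by
    refine sq_le_two_mul_of_lowCompanionFree (k := k + 3) A B hA hB α β c hc hβ hdet hper hm2 ?_
    intro j hj hjm d hd
    have hj3 : j < 3 := Nat.lt_of_mul_lt_mul_right (lt_of_le_of_lt hjm hlt)
    obtain rfl : j = 2 := le_antisymm (by omega) hj
    by_cases hdm : d ≤ m
    · rcases (show 2 * (k + 3 + 3) = d ∨ 2 * (k + 3 + 3) < d by omega) with h | h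
      · rw [← h, homogeneousComponent_coeff_det_two_two_mul (by omega) A B α β c hc hβ hdet hper, hW2,
          sub_self, mul_zero]
      · rw [homogeneousComponent_coeff_det_two_of_lt A B α β c hc hβ hdet hper h, hW d h hdm, mul_zero,
          neg_zero]
    · refine homogeneousComponent_eq_zero _ _ ?_
      have hdeg := totalDegree_coeff_det_le A B hA hB 2
      rw [Fintype.card_fin] at hdeg
      omega
  nlinarith

end ThreeN

end Summit.ValiantsHypothesis.ValiantsHypothesis.Theorems.GrenetZeonTwoDimCoefficients.ScalingClosure

end
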